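import Summits.ValiantsHypothesis.ValiantsHypothesis.Theorems.LangWeilTransferTameResolutionParamGenericNe
import Summits.ValiantsHypothesis.ValiantsHypothesis.Theorems.LangWeilTransferTameResolutionNormalize
import Summits.ValiantsHypothesis.ValiantsHypothesis.Theorems.LangWeilTransferTameResolutionCoordinateBasis
import Summits.ValiantsHypothesis.ValiantsHypothesis.Theorems.LangWeilTransferTameResolutionAlgebraicRelation
import Summits.ValiantsHypothesis.ValiantsHypothesis.Theorems.LangWeilTransferTameResolutionMinimal

/-!
# LangWeilTransfer, support item `TameResolution` (stmt-ValiantsHypothesis-6378) — the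
# Noether-free congruence model of a minimal component, WITH PROVENANCE

Route `LangWeilTransfer` of `ValiantsHypothesis` (conditional route; honest framing: bookkeeping,
nothing here bears on VP ≠ VNP, which is NOT proved). Step (4a) of the Noether-free quantitative
assembly of `TameResolution` (val-width-6373-p2 g2). For an integer system `S` and a minimal
prime `𝔭` of `(S) ⊂ ℚ[Y]`:

1. split the coordinates along a transcendence basis (`exists_coordinate_split`: `e`, `Γ`, with
   `S' = Γ ∘ S` of the same degrees and weights — no shears, no heights);
2. run the integer Kronecker parametrisation over that basis WITHOUT Noether position
   (`exists_parametrisation_generic'`: data `a, q, B, c, Q` and the defined `ρ, V, u`);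
3. normalise (`LangWeilTransferTameResolutionNormalize`): `Q♮ = integralNormalization Q` (monic,
   irreducible over `ℚ`), `u♮ = κ(T̄) u`, `ρ♮ = ρ κ^M`, `V♮_j = κ^{M - deg V_j} scaleRoots V_j κ`,
   base coordinates `V♮_k = ρ♮ T_k`;

and read the result in the CONGRUENCE-MODEL shape of val-width's
`tameResolution_of_congruenceModels` (`ℓ_k = Y_{e(inr k)}` algebraically independent modulo `𝔭`,
`Q♮(u♮, ℓ) ∈ 𝔭`, `ρ♮(ℓ) Y_i - V♮_i(u♮, ℓ) ∈ 𝔭`), keeping every datum explicit so that the size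
lemmas of the quantitative pass (val-lit-p6 g9: `q_sizes`, `rho_sizes`, `V_sizes`, `Q_sizes`, …
and this seat's `…Normalize`) can be bolted on.

* `exists_generic_model`.
-/

noncomputable section

open MvPolynomial
open Literature.RingTheory.Elimination
open Literature.Computability.AlgebraicComplexity (weight)

-- the summit and the problem share the name `ValiantsHypothesis` (D-0017 single-conjunct layout)
set_option linter.dupNamespace false

namespace Summit.ValiantsHypothesis.ValiantsHypothesis.Theorems.LangWeilTransfer

open Literature.RingTheory.NoetherNormalization in
/-- **Noether-free congruence model of a minimal component, with provenance** (see the module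
docstring for the three steps and the meaning of the data). -/
theorem exists_generic_model {m t d : ℕ} (S : Fin t → MvPolynomial (Fin m) ℤ)
    (hSd : ∀ i, (S i).totalDegree ≤ d) (𝔭 : Ideal (MvPolynomial (Fin m) ℚ))
    (h𝔭 : 𝔭 ∈ (Ideal.span (Set.range fun i => MvPolynomial.map (Int.castRingHom ℚ) (S i))).minimalPrimes) :
    ∃ (r n : ℕ) (e : Fin n ⊕ Fin r ≃ Fin m) (S' : Fin t → MvPolynomial (Fin n) (MvPolynomial (Fin r) ℤ))
      (a : Fin n × Fin t → ℕ) (q B : Polynomial (MvPolynomial (Fin n) (MvPolynomial (Fin r) ℤ)))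
      (c : Fin n → ℕ) (Q : Polynomial (MvPolynomial (Fin r) ℤ)),
      let ι := Fin r ⊕ (Fin n ⊕ (Fin n × Fin t))
      let F : Fin n → MvPolynomial (Fin n) (MvPolynomial ι ℤ) := fun i =>
        ∑ k : Fin t, C (X (Sum.inr (Sum.inr (i, k)))) *
          MvPolynomial.map (rename (Sum.inl : Fin r → ι) : MvPolynomial (Fin r) ℤ →ₐ[ℤ] MvPolynomial ι ℤ).toRingHom (S' k)
      let uU : MvPolynomial (Fin n) (MvPolynomial ι ℤ) := ∑ j : Fin n, C (X (Sum.inr (Sum.inl j))) * X j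
      let 𝒬 := sLead (pertCharpoly (d + 1) F uU (1 + n * d + 1))
      let σa : MvPolynomial ι ℤ →+* MvPolynomial (Fin n) (MvPolynomial (Fin r) ℤ) :=
        eval₂Hom (C.comp C) (Sum.elim (fun k => C (X k)) (Sum.elim (fun j => X j) (fun p => C (C ((a p : ℕ) : ℤ)))))
      let Res := Polynomial.resultant q (Polynomial.derivative q) q.natDegree (Polynomial.derivative q).natDegree
      let sp : MvPolynomial (Fin n) (MvPolynomial (Fin r) ℤ) →+* MvPolynomial (Fin r) ℤ :=
        eval fun j => ((c j : ℕ) : MvPolynomial (Fin r) ℤ)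
      let dq : Fin n → Polynomial (MvPolynomial (Fin n) (MvPolynomial (Fin r) ℤ)) := fun j =>
        optionEquivLeft _ (Fin n) (pderiv (some j) ((optionEquivLeft _ (Fin n)).symm q))
      let ρ := sp Res
      let V : Fin n → Polynomial (MvPolynomial (Fin r) ℤ) := fun j => -((dq j * B).map sp)
      -- normalisation
      let κ := Q.leadingCoeff
      let M := Finset.univ.sup fun j => (V j).natDegree
      let Qn := (finSuccEquiv ℤ r).symm (Polynomial.integralNormalization Q)
      let ρn := ρ * κ ^ M
      let Vn : Fin m → MvPolynomial (Fin (r + 1)) ℤ := fun i => Sum.elim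
        (fun j => (finSuccEquiv ℤ r).symm (Polynomial.C (κ ^ (M - (V j).natDegree)) * (V j).scaleRoots κ))
        (fun k => (finSuccEquiv ℤ r).symm (Polynomial.C (ρn * X k))) (e.symm i)
      let ℓ : Fin r → MvPolynomial (Fin m) ℚ := fun k => X (e (Sum.inr k))
      let uP : MvPolynomial (Fin m) ℚ := MvPolynomial.map (Int.castRingHom ℚ)
        (rename (fun k => e (Sum.inr k)) κ * ∑ j : Fin n, C ((c j : ℕ) : ℤ) * X (e (Sum.inl j)))
      n + r = m ∧
      (∀ k, (S' k).totalDegree ≤ d) ∧ (∀ k β, ((S' k).coeff β).totalDegree ≤ d) ∧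
      (∀ k, ((S' k).support.sum fun β => weight ((S' k).coeff β)) ≤ weight (S k)) ∧
      (∀ p, a p ≤ 𝒬.support.sup fun k => (𝒬.coeff k).totalDegree) ∧
      Irreducible q ∧ 0 < q.natDegree ∧ 𝒬.map σa ≠ 0 ∧ q ∣ 𝒬.map σa ∧
      B.degree < (q.natDegree : WithBot ℕ) ∧
      (∀ i : ℕ, B.coeff i = if h : i < q.natDegree then
        (Polynomial.sylvester q (Polynomial.derivative q) q.natDegree (Polynomial.derivative q).natDegree).adjugate
          (Fin.castAdd _ ⟨i, h⟩) ⟨0, by omega⟩ else 0) ∧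
      (∀ j, c j ≤ (Res * q.leadingCoeff).totalDegree) ∧
      q.map sp ≠ 0 ∧ Q ∣ q.map sp ∧ ρ ≠ 0 ∧ 0 < Q.natDegree ∧
      -- the congruence model
      (finSuccEquiv ℤ r Qn).leadingCoeff = C 1 ∧ 0 < (finSuccEquiv ℤ r Qn).natDegree ∧
      Irreducible (MvPolynomial.map (Int.castRingHom ℚ) Qn) ∧
      AlgebraicIndependent ℚ (fun k => Ideal.Quotient.mk 𝔭 (ℓ k)) ∧
      aeval (Fin.cons uP ℓ : Fin (r + 1) → MvPolynomial (Fin m) ℚ) (MvPolynomial.map (Int.castRingHom ℚ) Qn) ∈ 𝔭 ∧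
      ∀ i, aeval ℓ (MvPolynomial.map (Int.castRingHom ℚ) ρn) * X i -
        aeval (Fin.cons uP ℓ : Fin (r + 1) → MvPolynomial (Fin m) ℚ) (MvPolynomial.map (Int.castRingHom ℚ) (Vn i)) ∈ 𝔭 := by
  classical
  -- the generic point of the component
  haveI h𝔭P : 𝔭.IsPrime := h𝔭.1.1
  let A := Aff 𝔭
  let F₀ := Fun 𝔭
  -- cache the instances of the function field (instance search through `FractionRing` is slow)
  letI iCR : CommRing F₀ := inferInstance
  letI iF : Field F₀ := inferInstance
  letI iAlg : Algebra ℚ F₀ := inferInstance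
  letI iAlgA : Algebra A F₀ := inferInstance
  letI iTow : IsScalarTower ℚ A F₀ := inferInstance
  set π : MvPolynomial (Fin m) ℚ →+* F₀ := (algebraMap A F₀).comp (Ideal.Quotient.mk 𝔭) with hπ
  have hkerπ : RingHom.ker π = 𝔭 := by
    ext f
    rw [RingHom.mem_ker, hπ, RingHom.comp_apply, map_eq_zero_iff _ (IsFractionRing.injective A F₀),
      Ideal.Quotient.eq_zero_iff_mem]
  set πℤ : MvPolynomial (Fin m) ℤ →+* F₀ := π.comp (MvPolynomial.map (Int.castRingHom ℚ)) with hπℤ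
  have hkerℤ : RingHom.ker πℤ = 𝔭.comap (MvPolynomial.map (Int.castRingHom ℚ)) := by
    rw [hπℤ, ← RingHom.comap_ker, hkerπ]
  let y : Fin m → F₀ := fun i => πℤ (X i)
  have hyx : ∀ i, xF 𝔭 i = y i := fun i => by
    simp only [y, hπℤ, RingHom.comp_apply, map_X, hπ, xF]
    rfl
  have hπy : ∀ i, π (X i) = y i := fun i => by
    simp only [y, hπℤ, RingHom.comp_apply, map_X]
  -- (1) the coordinate split
  obtain ⟨r, n, e, Γ, hnr, hTB, hΓl, hΓr, hΓdeg, hΓcoeff, hΓwt⟩ := exists_coordinate_split 𝔭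
  have hΓsl : ∀ j, Γ.symm (X j) = X (e (Sum.inl j)) := fun j => by
    rw [← hΓl j, RingEquiv.symm_apply_apply]
  have hΓsr : ∀ k, Γ.symm (C (X k)) = X (e (Sum.inr k)) := fun k => by
    rw [← hΓr k, RingEquiv.symm_apply_apply]
  have hΓsC : ∀ g : MvPolynomial (Fin r) ℤ, Γ.symm (C g) = rename (fun k => e (Sum.inr k)) g := by
    intro g
    have h : Γ.symm.toRingHom.comp C = (rename (fun k => e (Sum.inr k)) :
        MvPolynomial (Fin r) ℤ →ₐ[ℤ] MvPolynomial (Fin m) ℤ).toRingHom := by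
      refine MvPolynomial.ringHom_ext (fun z => ?_) (fun k => ?_)
      · simp only [eq_intCast, map_intCast]
      · simp only [RingHom.comp_apply, RingEquiv.toRingHom_eq_coe, RingHom.coe_coe, AlgHom.toRingHom_eq_coe,
          rename_X, hΓsr]
    exact congrArg (fun φ => φ g) h
  set Tb : Fin r → F₀ := fun k => y (e (Sum.inr k)) with hTb
  have hTbx : Tb = fun k => xF 𝔭 (e (Sum.inr k)) := by funext k; rw [hTb, hyx]
  have hTB' : IsTranscendenceBasis ℚ Tb := by rw [hTbx]; exact hTB
  -- the transported system and the point
  set φ : MvPolynomial (Fin n) (MvPolynomial (Fin r) ℤ) →+* F₀ := πℤ.comp Γ.symm.toRingHom with hφ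
  have hφΓ : ∀ f, φ (Γ f) = πℤ f := fun f => by
    simp only [hφ, RingHom.comp_apply, RingEquiv.toRingHom_eq_coe, RingHom.coe_coe, RingEquiv.symm_apply_apply]
  have hφX : ∀ j, φ (X j) = y (e (Sum.inl j)) := fun j => by
    simp only [hφ, RingHom.comp_apply, RingEquiv.toRingHom_eq_coe, RingHom.coe_coe, hΓsl, y]
  have hφC : ∀ k, φ (C (X k)) = Tb k := fun k => by
    simp only [hφ, RingHom.comp_apply, RingEquiv.toRingHom_eq_coe, RingHom.coe_coe, hΓsr, hTb, y]
  set θℚ : MvPolynomial (Fin r) ℚ →+* F₀ := (aeval Tb : MvPolynomial (Fin r) ℚ →ₐ[ℚ] F₀).toRingHom with hθℚ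
  have hθℚX : ∀ k, θℚ (X k) = φ (C (X k)) := fun k => by
    simp only [hθℚ, AlgHom.toRingHom_eq_coe, RingHom.coe_coe, aeval_X, hφC]
  have hθℚinj : Function.Injective θℚ := algebraicIndependent_iff_injective_aeval.1 hTB'.1
  have hθ : θℚ.comp (MvPolynomial.map (Int.castRingHom ℚ)) = φ.comp MvPolynomial.C := by
    refine MvPolynomial.ringHom_ext (fun z => ?_) (fun k => ?_)
    · simp only [eq_intCast, map_intCast]
    · simp only [RingHom.comp_apply, map_X, hθℚX]
  have hθinj : Function.Injective (φ.comp MvPolynomial.C) := by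
    rw [← hθ]
    exact hθℚinj.comp (MvPolynomial.map_injective _ (RingHom.injective_int (Int.castRingHom ℚ)))
  let S' : Fin t → MvPolynomial (Fin n) (MvPolynomial (Fin r) ℤ) := fun k => Γ (S k)
  have hSd' : ∀ k, (S' k).totalDegree ≤ d := fun k => (hΓdeg _).trans (hSd k)
  have hSπ : ∀ k, πℤ (S k) = 0 := fun k => by
    rw [← RingHom.mem_ker, hkerℤ, Ideal.mem_comap, ← hkerπ, RingHom.mem_ker, ← RingHom.mem_ker, hkerπ]
    exact h𝔭.1.2 (Ideal.subset_span ⟨k, rfl⟩)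
  have hSφ : ∀ k, φ (S' k) = 0 := fun k => by
    change φ (Γ (S k)) = 0
    rw [hφΓ]; exact hSπ k
  have hmin := ringEquiv_minimal_transport S 𝔭 h𝔭 πℤ hkerℤ Γ
  have halg : ∀ j, ∃ P : Polynomial (MvPolynomial (Fin r) ℤ), P ≠ 0 ∧
      (P.map (φ.comp MvPolynomial.C)).eval (φ (X j)) = 0 := by
    intro j
    -- a `ℚ[T]`-relation from the transcendence basis (as in `exists_rat_relation_of_isTranscendenceBasis`,
    -- reproved here to stay with the `ℚ`-algebra structure of the fraction field)
    have hrat : ∃ p : Polynomial (MvPolynomial (Fin r) ℚ), p ≠ 0 ∧ (p.map θℚ).eval (φ (X j)) = 0 := by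
      set R₁ : Subalgebra ℚ F₀ := Algebra.adjoin ℚ (Set.range Tb) with hR₁
      haveI : Algebra.IsAlgebraic R₁ F₀ := hTB'.isAlgebraic
      obtain ⟨p, hp0, hp⟩ := (Algebra.IsAlgebraic.isAlgebraic (R := R₁) (φ (X j)))
      let ρ₁ : MvPolynomial (Fin r) ℚ →+* R₁ :=
        ((aeval Tb : MvPolynomial (Fin r) ℚ →ₐ[ℚ] F₀).codRestrict R₁ fun g => by
          rw [hR₁, ← MvPolynomial.aeval_range]; exact ⟨g, rfl⟩).toRingHom
      have hρsurj : Function.Surjective ρ₁ := by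
        rintro ⟨z, hz⟩
        rw [hR₁, ← MvPolynomial.aeval_range] at hz
        obtain ⟨g, rfl⟩ := hz
        exact ⟨g, rfl⟩
      have hlift : p ∈ Polynomial.lifts ρ₁ := by
        rw [Polynomial.lifts_iff_coeff_lifts]
        intro k; exact hρsurj _
      obtain ⟨g, hgp⟩ := (Polynomial.mem_lifts p).1 hlift
      refine ⟨g, ?_, ?_⟩
      · rintro rfl
        rw [Polynomial.map_zero] at hgp
        exact hp0 hgp.symm
      · have hcomp : θℚ = (algebraMap R₁ F₀).comp ρ₁ := by
          rw [hθℚ]; ext z <;> rfl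
        rw [hcomp, ← Polynomial.map_map, hgp, Polynomial.eval_map]
        exact hp
    obtain ⟨p, hp0, hp⟩ := hrat
    obtain ⟨P, hP0, hP⟩ := exists_int_relation_of_rat θℚ (φ (X j)) p hp0 hp
    exact ⟨P, hP0, by rw [← hθ]; exact hP⟩
  -- (2) the parametrisation over the transcendence basis
  obtain ⟨a, q, B, c, Q, haN, hqirr, hqdeg, h𝒬a0, hq𝒬, hBdeg, hBcoeff, hcN, hqc0, hQdvd, hρ0, hQdeg, hQℚirr,
    hQu, hgraph⟩ := exists_parametrisation_generic' S' hSd' φ hθinj halg hSφ hmin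
  refine ⟨r, n, e, S', a, q, B, c, Q, ?_⟩
  intro ι F uU 𝒬 σa Res sp dq ρ V κ M Qn ρn Vn ℓ uP
  have hQ0 : Q ≠ 0 := fun h => by rw [h, Polynomial.natDegree_zero] at hQdeg; exact lt_irrefl 0 hQdeg
  -- transfer tools: membership in `𝔭` from vanishing in `F₀`
  have hmem : ∀ g : MvPolynomial (Fin m) ℚ, π g = 0 → g ∈ 𝔭 := fun g hg => by
    rw [← hkerπ, RingHom.mem_ker]; exact hg
  let πₐ : MvPolynomial (Fin m) ℚ →ₐ[ℚ] F₀ := (IsScalarTower.toAlgHom ℚ A F₀).comp (Ideal.Quotient.mkₐ ℚ 𝔭)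
  have hπₐ : ∀ g, πₐ g = π g := fun g => rfl
  have hπaeval : ∀ {σ : Type} (v : σ → MvPolynomial (Fin m) ℚ) (G : MvPolynomial σ ℚ),
      π (aeval v G) = aeval (fun s => π (v s)) G := by
    intro σ v G
    rw [← hπₐ, ← AlgHom.comp_apply, MvPolynomial.comp_aeval]
    rfl
  set θ := φ.comp MvPolynomial.C with hθdef
  set u : F₀ := ∑ j, ((c j : ℕ) : F₀) * φ (X j) with hu
  have hπℓ : (fun k => π (ℓ k)) = Tb := by
    funext k; simp only [ℓ, hπy, hTb]
  have hθℚℓ : (aeval (fun k => π (ℓ k)) : MvPolynomial (Fin r) ℚ →ₐ[ℚ] F₀).toRingHom = θℚ := by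
    rw [hπℓ]
  -- `π` of an `r`-variate integer polynomial at `ℓ` is `θ`
  have hπr : ∀ g : MvPolynomial (Fin r) ℤ, π (aeval ℓ (MvPolynomial.map (Int.castRingHom ℚ) g)) = θ g := by
    intro g
    rw [hπaeval, ← hθ, RingHom.comp_apply]
    change (aeval (fun k => π (ℓ k)) : MvPolynomial (Fin r) ℚ →ₐ[ℚ] F₀).toRingHom _ = _
    rw [hθℚℓ]
  -- `π uP = κ(T̄) · u`
  have hπuP : π uP = θ κ * u := by
    change πℤ (rename (fun k => e (Sum.inr k)) κ * ∑ j : Fin n, C ((c j : ℕ) : ℤ) * X (e (Sum.inl j))) = _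
    rw [map_mul, map_sum, ← hΓsC]
    change φ (C κ) * _ = _
    rw [hθdef, RingHom.comp_apply, hu]
    congr 1
    refine Finset.sum_congr rfl fun j _ => ?_
    rw [map_mul, map_natCast, map_natCast, hφX]
  -- `π` of an `(r+1)`-variate integer polynomial at `(uP, ℓ)` is the evaluation at `(T̄, κ u)`
  have hπr1 : ∀ P : Polynomial (MvPolynomial (Fin r) ℤ),
      π (aeval (Fin.cons uP ℓ : Fin (r + 1) → MvPolynomial (Fin m) ℚ)
        (MvPolynomial.map (Int.castRingHom ℚ) ((finSuccEquiv ℤ r).symm P))) = (P.map θ).eval (θ κ * u) := by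
    intro P
    rw [hπaeval]
    have hx : (fun s => π ((Fin.cons uP ℓ : Fin (r + 1) → MvPolynomial (Fin m) ℚ) s)) =
        Fin.cons (θ κ * u) (fun k => π (ℓ k)) := by
      funext s
      refine Fin.cases ?_ (fun k => ?_) s
      · simp only [Fin.cons_zero, hπuP]
      · simp only [Fin.cons_succ]
    have hfin : MvPolynomial.map (Int.castRingHom ℚ) ((finSuccEquiv ℤ r).symm P) =
        (finSuccEquiv ℚ r).symm (P.map (MvPolynomial.map (Int.castRingHom ℚ))) := by
      apply (finSuccEquiv ℚ r).injective
      rw [AlgEquiv.apply_symm_apply, Literature.AlgebraicGeometry.Motives.TwoPointPencil.finSuccEquiv_map,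
        AlgEquiv.apply_symm_apply]
    rw [hx, hfin, Literature.AlgebraicGeometry.Motives.TwoPointPencil.aeval_cons_eq_aevalTower,
      AlgEquiv.apply_symm_apply]
    change Polynomial.eval₂ (aeval (fun k => π (ℓ k)) : MvPolynomial (Fin r) ℚ →ₐ[ℚ] F₀).toRingHom (θ κ * u)
      (P.map (MvPolynomial.map (Int.castRingHom ℚ))) = _
    rw [hθℚℓ, ← Polynomial.eval_map, Polynomial.map_map, hθ]
  refine ⟨hnr, hSd', fun k β => (hΓcoeff _ β).trans (hSd k), fun k => hΓwt _, haN, hqirr, hqdeg, h𝒬a0, hq𝒬,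
    hBdeg, hBcoeff, hcN, hqc0, hQdvd, hρ0, hQdeg, leadingCoeff_finSuccEquiv_integralNormalization Q hQ0,
    by rw [natDegree_finSuccEquiv_integralNormalization]; exact hQdeg,
    irreducible_map_finSuccEquiv_symm_integralNormalization Q hQℚirr hQdeg, ?_, hmem _ ?_, fun i => hmem _ ?_⟩
  · -- algebraic independence of the basis coordinates modulo `𝔭`
    have h1 : AlgebraicIndependent ℚ (fun k => xF 𝔭 (e (Sum.inr k))) := hTB.1
    refine AlgebraicIndependent.of_comp (IsScalarTower.toAlgHom ℚ A F₀) ?_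
    have hfun : (⇑(IsScalarTower.toAlgHom ℚ A F₀) ∘ fun k => Ideal.Quotient.mk 𝔭 (ℓ k)) =
        fun k => xF 𝔭 (e (Sum.inr k)) := by
      funext k; rfl
    rw [hfun]; exact h1
  · -- the root `Q♮(u♮, ℓ) ∈ 𝔭`
    rw [hπr1]
    exact eval_integralNormalization_eq_zero θ hθinj Q hQu
  · -- the congruences
    obtain ⟨v, rfl⟩ := e.surjective i
    rcases v with j | k
    · -- a fibre coordinate: the rescaled graph relation
      have hM : (V j).natDegree ≤ M := Finset.le_sup (f := fun j => (V j).natDegree) (Finset.mem_univ j)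
      have hg := eval_scaleRoots_graph θ κ ρ (V j) hM (ξ := φ (X j)) (u := u) (hgraph j)
      have hVn : Vn (e (Sum.inl j)) =
          (finSuccEquiv ℤ r).symm (Polynomial.C (κ ^ (M - (V j).natDegree)) * (V j).scaleRoots κ) := by
        simp only [Vn, Equiv.symm_apply_apply, Sum.elim_inl]
      rw [map_sub, map_mul, hπr, hπy, ← hφX, hVn, hπr1, ← hg, mul_comm, sub_self]
    · -- a basis coordinate: `ρ♮ T_k`
      have hVn : Vn (e (Sum.inr k)) = (finSuccEquiv ℤ r).symm (Polynomial.C (ρn * X k)) := by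
        simp only [Vn, Equiv.symm_apply_apply, Sum.elim_inr]
      have hcomp : ((Fin.cons uP ℓ : Fin (r + 1) → MvPolynomial (Fin m) ℚ) ∘ Fin.succ) = ℓ := by
        funext k'; simp only [Function.comp_apply, Fin.cons_succ]
      have hzero : aeval ℓ (MvPolynomial.map (Int.castRingHom ℚ) ρn) * X (e (Sum.inr k)) -
          aeval (Fin.cons uP ℓ : Fin (r + 1) → MvPolynomial (Fin m) ℚ)
            (MvPolynomial.map (Int.castRingHom ℚ) (Vn (e (Sum.inr k)))) = 0 := by
        rw [hVn, finSuccEquiv_symm_C, MvPolynomial.map_rename, aeval_rename, hcomp,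
          map_mul (MvPolynomial.map (Int.castRingHom ℚ)) ρn (X k), map_X,
          map_mul (aeval ℓ) (MvPolynomial.map (Int.castRingHom ℚ) ρn) (X k), aeval_X]
        exact sub_self _
      rw [hzero, map_zero]

end Summit.ValiantsHypothesis.ValiantsHypothesis.Theorems.LangWeilTransfer

end
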